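import Literature.MathematicalPhysics.QuantumFieldTheory.Balaban1983to89.Node00.TorusCoverCubeMemberRecordDentZd
import Literature.MathematicalPhysics.QuantumFieldTheory.Balaban1983to89.Node00.TwoRunSiteBlockAnimals
import Literature.MathematicalPhysics.QuantumFieldTheory.Balaban1983to89.Node00.DomainsOfSeq

/-!
# NODE 00 — THE DENTED TOP `□̃ᶻ_j ∩ liftTopZ j (Ω_j^{(j)})` OF THE RECORD DATUM IS A UNION OF ANCHORED `L^{s+1}·Lʲ`-SUPERBLOCKS when the dent modulus `L^{s+1}` divides the
# collar `ρ` and `M·R_j`, and the `𝐃_j`-cube side `Lʲ·M·R_j` divides the torus period — [Balaban1988Convergent] (2.1) p. 254 («unions of M R_j-cubes», `M`, `R_j` powers of `L`)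
# read on the `ℤᵈ` cover: the R8 DENT PREMISE of the pre-composed crown, DISCHARGED from the grid guard's divisibility letters

Cell `pub-ymgap`, width seat `pub-ymgap-dag-n07-w3` g13 (junction side of the K0 road).  `--kind proof --supports stmt-QuantumFields-20541` (K0⁷; count-neutral; THEOREMS ONLY, 0 `def`).
[III] = [Balaban1988Convergent]; [I] = [Balaban1987RG1]; [15] = [Balaban1985Variational].
CONSUMED BY NAME: this seat's ✓p749305 `Node00.TorusCoverCubeMemberRecordDentZd` (`liftTopZ`, `dentFamZ`, `dentFamZ_top`), dag-n14's `Node00.TwoRunSiteBlockAnimals` §4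
(`box_stable_of_same_block`, the one-coordinate saturation arithmetic), `Node00.DomainsOfSeq` (`mem_domainsOfSeq_Om_iff_subset`), `Node00.LargeFieldReprOfRecord` (`unionsOfCubes`,
`DOfRecord`, `SeqOfRecord`, `dCubeSide`), `B8Ineq130Rec.tlo_apply ∕ thi_apply`.

WHY.  The pre-composed crown of road (B′) (dag-n05-e F1–F8) is stated for a dented record datum whose TOP `Ω′_j = □̃ᶻ_j ∩ lift(Ω_j)` ([15] (150)) is a union of the crown's
`L^{s+1}·Lʲ`-superblocks anchored at `Lʲ·(corner − ρ) − c_j` (its premise R8, DISPLAYED per datum in this seat's ✓p751907 `DatumCrownPhiAt` :85–88).  The def of record's guard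
edition (c-ii)‴ `HThm4RecSym152PhiEG F N Mc ρ Md κ a₀ Ψ` (dag-n07-e ✓p752342) carries the datum row «`Md ∣ M·R_j` and `Lʲ·M·R_j ∣ sitesPerDir 0`» ([III] (2.1) p.254: `M`, `R_j`
powers of `L`; the registered K0 guard A‴).  THIS FILE proves R8 from that row at `Md := L^{s+1}` and `L^{s+1} ∣ ρ` (the junction's `ρ = ρ₀·L`, `ρmin ∣ ρ₀`): the window
`□̃ᶻ_j` is superblock-saturated because its corner `cornerP` lies on the `ρ`-grid and its side `sideP` is a multiple of `ρ` (§2), and the lift of `Ω_j` is because `Ω_j` is a union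
of `Lʲ·M·R_j`-cubes of the torus whose pull-back to `ℤᵈ` is a union of standard `L^{s+1}·Lʲ`-cubes (§3: `L^{s+1}·Lʲ ∣ Lʲ·M·R_j ∣ period`).

WHAT IS PROVED (sorry-free; integer bookkeeping, NO estimate).
§1 `alignedBox_mem_iff_ediv` (membership of `t` in `[Q·a, Q·b − 1]` depends on `t ∕ Q` only), `blockMap_add_mul_const` (`⌊(x + Q·γ)∕Q⌋ = ⌊x∕Q⌋ + γ`).
§2 ★ `tcubeZ_superblockSaturated` — `□̃ᶻ_j = tcubeZ L (cornerP …) (sideP …) ρ j` is a union of `Q·Lʲ`-superblocks anchored at `Lʲ·(cornerP − ρ) − c_j` whenever `Q ∣ ρ`.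
§3 ★ `cover_mem_cubeEnl_of_blockMap_eq` (the pull-back of an `S`-cube of the torus is `B`-block-saturated on `ℤᵈ` when `B ∣ S` and `B ∣ sitesPerDir 0`), `…_unionsOfCubes_…`,
   ★ `mem_liftTopZ_domainsOfSeq_iff` (for a decreasing, level-`j`-saturated sequence: `x ∈ liftTopZ j (Ω_j^{(j)}) ↔ cover (x + c_j·𝟙) ∈ Ω_j`), ★★ `liftTopZ_superblockSaturated`.
§4 ★★★ `dentFamZ_top_superblockSaturated` (generic regions) and ★★★ `dentFamZ_top_superblockSaturated_seqOfRecord` — THE R8 PREMISE OF `DatumCrownPhiAt` AT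
   `Dtop := (domainsOfSeq s.Ω j hk).Om j` FROM THE (c-ii)‴ DATUM ROW at `Md := L^{s+1}` and `L^{s+1} ∣ ρ`, verbatim in the adapter's shape.
HONEST FRAMING: count-neutral helper; bookkeeping on [III] (2.1)'s cube partitions — nothing of [III]∕[15] asserted or discharged; `DatumCrownPhiAt` ∕ `HThm4RecSym152PhiE(G)` ∕
`HThm4Rec*` remain DISPLAYED ∕ CONDITIONAL premises; N05 ∕ N07 NOT discharged; K0⁷ ∕ K1⁹ NOT closed; counts unmoved (typed 28∕28 · discharged 8∕28); one finite 𝕋⁴ programme at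
fixed ε — R4 closes the conditional finite-𝕋⁴ rung `BalabanLadder.UV` only; the YM mass gap (Clay) is NOT proved by any of this; nothing continuum ∕ ℝ⁴ ∕ OS.  No `def`, no `sorry`,
no `instance`, no `notation`.

References: [III] (2.1)–(2.2) p. 254–255, (2.5) p. 255; [I] (0.1) p. 251, (0.3) p. 252; [15] (148)–(150) p. 301.
-/

set_option autoImplicit false

namespace Literature.MathematicalPhysics.QuantumFieldTheory.Balaban1983to89.Node00

open Literature.MathematicalPhysics.QuantumLattice (blockMap)
open BlockAveragingZd (ctrShift)
open B8Eq131Cubes (tLo tHi)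
open B8Eq131CubesRec (tcubeZ)
open B8Ineq130Rec (tlo thi tlo_apply thi_apply)
open B15Eq112TorusCover (cover cover_apply)
open B14DomainGeom (Pt)
open B14.Eq213MaximalDomains (cubeExt)
open B5Eq118OneStroke (iterBlockOf)
open T4Continuum (T4Family)

/-! ## §1  Integer bookkeeping -/

/-- Membership of an integer in the aligned box `[Q·a, Q·b − 1]` (`Q > 0`) depends only on its `Q`-block label `t ∕ Q`. [folklore] -/
private theorem alignedBox_mem_iff_ediv {Q a b t : ℤ} (hQ : 0 < Q) : (Q * a ≤ t ∧ t ≤ Q * b - 1) ↔ (a ≤ t / Q ∧ t / Q < b) := by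
  rw [Int.le_ediv_iff_mul_le hQ, Int.ediv_lt_iff_lt_mul hQ]
  constructor
  · rintro ⟨h1, h2⟩; exact ⟨by linarith, by linarith⟩
  · rintro ⟨h1, h2⟩; exact ⟨by linarith, by linarith⟩

/-- `⌊(x + Q·γ)∕Q⌋ = ⌊x∕Q⌋ + γ` coordinatewise. [folklore] -/
private theorem blockMap_add_mul_const {d : ℕ} (Q : ℕ) (hQ : 0 < Q) (x γ : Fin d → ℤ) :
    blockMap Q (x + fun i => (Q : ℤ) * γ i) = blockMap Q x + γ := by
  funext i
  show (x i + (Q : ℤ) * γ i) / (Q : ℤ) = x i / (Q : ℤ) + γ i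
  rw [mul_comm, Int.add_mul_ediv_right _ _ (by exact_mod_cast hQ.ne')]

/-! ## §2  The window `□̃ᶻ_j` is a union of anchored superblocks -/

section Window

variable {P : Params}

/-- ★ **THE WINDOW `□̃ᶻ_j` IS SUPERBLOCK-SATURATED**: for `Q ∣ ρ` the scaled collared cube `tcubeZ L (cornerP P Mc ρ a) (sideP P Mc ρ) ρ j` — lower corner `Lʲ·(cornerP − 2ρ) − c_j`,
upper corner `Lʲ·(cornerP + sideP − 1 + 2ρ) + c_j`, `cornerP` on the `ρ`-grid, `ρ ∣ sideP` — contains with `x` every `y` in the same `Q·Lʲ`-block anchored at `Lʲ·(cornerP − ρ) − c_j`.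
[cite: Balaban1988Convergent, (2.1) p.254 (bookkeeping); Balaban1985Variational, (144) p.300] -/
theorem tcubeZ_superblockSaturated {Q : ℕ} (hQ : 0 < Q) (Mc ρ : ℕ) (hρ : Q ∣ ρ) (a : Pt P.d) (j : ℕ) ⦃x y : Pt P.d⦄
    (h : blockMap (Q * P.L ^ j) (x - fun i => (P.L : ℤ) ^ j * (cornerP P Mc ρ a i - ρ) - (ctrShift P.L j : ℤ)) =
      blockMap (Q * P.L ^ j) (y - fun i => (P.L : ℤ) ^ j * (cornerP P Mc ρ a i - ρ) - (ctrShift P.L j : ℤ)))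
    (hx : x ∈ tcubeZ P.L (cornerP P Mc ρ a) (sideP P Mc ρ) ρ j) : y ∈ tcubeZ P.L (cornerP P Mc ρ a) (sideP P Mc ρ) ρ j := by
  obtain ⟨q, hq⟩ := hρ
  have hL : Odd P.L := P.hL.1
  have hB : (0 : ℤ) < ((Q * P.L ^ j : ℕ) : ℤ) := by exact_mod_cast Nat.mul_pos hQ (pow_pos P.L_pos j)
  have hc2 : 2 * (ctrShift P.L j : ℤ) = (P.L : ℤ) ^ j - 1 := by
    have h := BlockAveragingZd.two_mul_ctrShift_add_one hL j
    zify at h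
    linarith
  -- the side is a multiple of `ρ`, `ρ` a multiple of `Q`
  have hS : ((sideP P Mc ρ : ℕ) : ℤ) = (ρ : ℤ) * ((((Mc + 11 * P.d) / ρ + 2 : ℕ) : ℤ)) := by simp [sideP]
  have hq' : ((ρ : ℕ) : ℤ) = (Q : ℤ) * (q : ℤ) := by rw [hq]; push_cast; ring
  have hBz : ((Q * P.L ^ j : ℕ) : ℤ) = (Q : ℤ) * (P.L : ℤ) ^ j := by push_cast; ring
  intro i
  have hxi := hx i
  have hhi := congrFun h i
  simp only [Literature.MathematicalPhysics.QuantumLattice.blockMap, Pi.sub_apply] at hhi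
  rw [tlo_apply hL, thi_apply hL] at hxi ⊢
  simp only [tLo, tHi] at hxi ⊢
  -- the window's corners relative to the anchor `w = Lʲ·(c_i − ρ) − c_j`: `−Lʲρ = (Q·Lʲ)·(−q)` and `Lʲ(sideP + 3ρ) − 1 = (Q·Lʲ)·(q·(n + 3)) − 1`
  have e1 : (P.L : ℤ) ^ j * (cornerP P Mc ρ a i - 2 * ((ρ : ℕ) : ℤ)) - (ctrShift P.L j : ℤ) =
      ((P.L : ℤ) ^ j * (cornerP P Mc ρ a i - ((ρ : ℕ) : ℤ)) - (ctrShift P.L j : ℤ)) + ((Q * P.L ^ j : ℕ) : ℤ) * (-(q : ℤ)) := by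
    rw [hBz]; linear_combination (-(P.L : ℤ) ^ j) * hq'
  have e2 : (P.L : ℤ) ^ j * (cornerP P Mc ρ a i + ((sideP P Mc ρ : ℕ) : ℤ) - 1 + 2 * ((ρ : ℕ) : ℤ)) + (ctrShift P.L j : ℤ) =
      ((P.L : ℤ) ^ j * (cornerP P Mc ρ a i - ((ρ : ℕ) : ℤ)) - (ctrShift P.L j : ℤ)) +
        (((Q * P.L ^ j : ℕ) : ℤ) * ((q : ℤ) * ((((Mc + 11 * P.d) / ρ + 2 : ℕ) : ℤ) + 3)) - 1) := by
    rw [hBz]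
    linear_combination (P.L : ℤ) ^ j * hS + (P.L : ℤ) ^ j * (((((Mc + 11 * P.d) / ρ + 2 : ℕ) : ℤ)) + 3) * hq' + hc2
  -- membership of `x`, `y` in the window in terms of the anchored coordinate `t − w`
  have key : ∀ t : ℤ, ((P.L : ℤ) ^ j * (cornerP P Mc ρ a i - 2 * ((ρ : ℕ) : ℤ)) - (ctrShift P.L j : ℤ) ≤ t ∧
      t ≤ (P.L : ℤ) ^ j * (cornerP P Mc ρ a i + ((sideP P Mc ρ : ℕ) : ℤ) - 1 + 2 * ((ρ : ℕ) : ℤ)) + (ctrShift P.L j : ℤ)) ↔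
      (-(q : ℤ) ≤ (t - ((P.L : ℤ) ^ j * (cornerP P Mc ρ a i - ((ρ : ℕ) : ℤ)) - (ctrShift P.L j : ℤ))) / ((Q * P.L ^ j : ℕ) : ℤ) ∧
        (t - ((P.L : ℤ) ^ j * (cornerP P Mc ρ a i - ((ρ : ℕ) : ℤ)) - (ctrShift P.L j : ℤ))) / ((Q * P.L ^ j : ℕ) : ℤ) <
          (q : ℤ) * ((((Mc + 11 * P.d) / ρ + 2 : ℕ) : ℤ) + 3)) := by
    intro t
    rw [← alignedBox_mem_iff_ediv hB]
    constructor
    · rintro ⟨h1, h2⟩; constructor <;> linarith [e1, e2]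
    · rintro ⟨h1, h2⟩; constructor <;> linarith [e1, e2]
  exact (key (y i)).2 (hhi ▸ (key (x i)).1 hxi)

end Window

/-! ## §3  The lift of a union of aligned torus cubes is a union of standard superblocks -/

section Lift

variable {P : Params}

/-- ★ **THE PULL-BACK OF AN ALIGNED TORUS CUBE IS SUPERBLOCK-SATURATED ON `ℤᵈ`**: if `B ∣ S` and `B ∣ sitesPerDir 0`, then for `z, z′ ∈ ℤᵈ` in one standard `B`-block,
`cover z ∈ cubeEnl P S a 0 → cover z′ ∈ cubeEnl P S a 0` (the cover point of `z` in the cube, moved by `z′ − z`, stays in the cube — `box_stable_of_same_block`).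
[cite: Balaban1988Convergent, (2.1) p.254 (bookkeeping); Balaban1987RG1, (0.1) p.251] -/
theorem cover_mem_cubeEnl_of_blockMap_eq {B S : ℕ} (hB : 0 < B) (hBS : B ∣ S) (hBN : B ∣ P.sitesPerDir 0) (a : Pt P.d) ⦃z z' : Pt P.d⦄
    (h : blockMap B z = blockMap B z') (hz : cover P z ∈ cubeEnl P S a 0) : cover P z' ∈ cubeEnl P S a 0 := by
  obtain ⟨S', hS'⟩ := hBS
  obtain ⟨n, hn⟩ := hBN
  have hQ : (0 : ℤ) < (B : ℤ) := by exact_mod_cast hB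
  unfold cubeEnl at hz ⊢
  obtain ⟨w, hw, hwz⟩ := hz
  simp only [Nat.zero_mul, Nat.cast_zero] at hw ⊢
  refine ⟨fun μ => w μ + (z' μ - z μ), ?_, ?_⟩
  · intro μ
    have hwμ := hw μ
    -- `w μ ≡ z μ` modulo the period
    have hcong : ∃ t : ℤ, w μ = z μ + (B : ℤ) * n * t := by
      have h1 : ((w μ : ℤ) : ZMod (P.sitesPerDir 0)) = ((z μ : ℤ) : ZMod (P.sitesPerDir 0)) := by
        have := congrFun hwz μ
        simpa only [cover_apply] using this
      obtain ⟨t, ht⟩ := (ZMod.intCast_eq_intCast_iff_dvd_sub _ _ (P.sitesPerDir 0)).1 h1.symm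
      refine ⟨t, ?_⟩
      have hN : ((P.sitesPerDir 0 : ℕ) : ℤ) = (B : ℤ) * n := by rw [hn]; push_cast; ring
      rw [← hN]
      linarith
    obtain ⟨t, ht⟩ := hcong
    have hb : z μ / (B : ℤ) = z' μ / (B : ℤ) := congrFun h μ
    have hSS : ((S : ℕ) : ℤ) = (B : ℤ) * (S' : ℤ) := by rw [hS']; push_cast; ring
    have hlo : (B : ℤ) * (S' : ℤ) * a μ ≤ w μ := by rw [mul_comm (B : ℤ), ← mul_comm (B : ℤ), ← hSS]; linarith [hwμ.1]
    have hhi : w μ ≤ (B : ℤ) * (S' : ℤ) * a μ + (B : ℤ) * (S' : ℤ) - 1 := by rw [← hSS]; linarith [hwμ.2]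
    have hmain := box_stable_of_same_block (k := a μ) hQ hlo hhi ht hb
    rw [hSS]
    exact ⟨by linarith [hmain.1], by linarith [hmain.2]⟩
  · funext μ
    have hwzμ : ((w μ : ℤ) : ZMod (P.sitesPerDir 0)) = ((z μ : ℤ) : ZMod (P.sitesPerDir 0)) := by
      have := congrFun hwz μ
      simpa only [cover_apply] using this
    simp only [cover_apply, Int.cast_add, Int.cast_sub, hwzμ]
    abel

/-- The same for a union of aligned cubes `Z ∈ unionsOfCubes P S`. [cite: Balaban1988Convergent, (2.1) p.254 (bookkeeping)] -/
theorem cover_mem_of_mem_unionsOfCubes_of_blockMap_eq {B S : ℕ} (hB : 0 < B) (hBS : B ∣ S) (hBN : B ∣ P.sitesPerDir 0) {Z : Set (Site P 0)}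
    (hZ : Z ∈ unionsOfCubes P S) ⦃z z' : Pt P.d⦄ (h : blockMap B z = blockMap B z') (hz : cover P z ∈ Z) : cover P z' ∈ Z := by
  obtain ⟨A, -, rfl⟩ := (mem_unionsOfCubes_iff P S Z).1 hZ
  simp only [Set.mem_iUnion, exists_prop] at hz ⊢
  obtain ⟨a, ha, hza⟩ := hz
  exact ⟨a, ha, cover_mem_cubeEnl_of_blockMap_eq hB hBS hBN a h hza⟩

/-- ★ **THE LIFT OF THE RUN's TOP REGION, READ ON THE FINE TORUS**: for a sequence of regions decreasing below `j` whose level-`j` entry is `j`-block-saturated (`1 ≤ j ≤ m + K`),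
`x ∈ liftTopZ P j ((domainsOfSeq Ω j hk).Om j) ↔ cover P (x + c_j·𝟙) ∈ Ω j`. [cite: Balaban1988Convergent, (2.1)–(2.2) p.254–255; Balaban1987RG1, (0.1) p.251, (0.3) p.252] -/
theorem mem_liftTopZ_domainsOfSeq_iff (Ω : ℕ → Set (Site P 0)) {j : ℕ} (hk : j ≤ P.m + P.K) (hj1 : 1 ≤ j)
    (hnest : ∀ i : ℕ, 1 ≤ i → i < j → Ω (i + 1) ⊆ Ω i)
    (hsat : ∀ ⦃x x' : Site P 0⦄, iterBlockOf j x = iterBlockOf j x' → x ∈ Ω j → x' ∈ Ω j) (x : Pt P.d) :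
    x ∈ liftTopZ P j ((domainsOfSeq Ω j hk).Om j) ↔ cover P (x + fun _ => ((ctrShift P.L j : ℕ) : ℤ)) ∈ Ω j := by
  rw [mem_liftTopZ_iff, mem_domainsOfSeq_Om_iff_subset Ω hk hnest hj1 le_rfl]
  constructor
  · exact fun h => h _ rfl
  · intro h x' hx'
    exact hsat hx'.symm h

/-- ★★ **THE LIFT OF THE RUN's TOP REGION IS SUPERBLOCK-SATURATED**: with `Ω` as above, `Ω j` a union of aligned `S`-cubes, `Q·Lʲ ∣ S`, `Q·Lʲ ∣ sitesPerDir 0`, and an anchor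
`v` with `v + c_j·𝟙 ∈ (Q·Lʲ)·ℤᵈ`: `⌊(x − v)∕(Q·Lʲ)⌋ = ⌊(y − v)∕(Q·Lʲ)⌋ → x ∈ liftTopZ … → y ∈ liftTopZ …`.
[cite: Balaban1988Convergent, (2.1)–(2.2) p.254–255; Balaban1987RG1, (0.1) p.251, (0.3) p.252] -/
theorem liftTopZ_superblockSaturated (Ω : ℕ → Set (Site P 0)) {j : ℕ} (hk : j ≤ P.m + P.K) (hj1 : 1 ≤ j)
    (hnest : ∀ i : ℕ, 1 ≤ i → i < j → Ω (i + 1) ⊆ Ω i) {B S : ℕ} (hB : 0 < B) (hLB : P.L ^ j ∣ B) (hBS : B ∣ S) (hBN : B ∣ P.sitesPerDir 0)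
    (hΩ : Ω j ∈ unionsOfCubes P S) (v γ : Pt P.d) (hv : (v + fun _ => ((ctrShift P.L j : ℕ) : ℤ)) = fun i => (B : ℤ) * γ i) ⦃x y : Pt P.d⦄
    (h : blockMap B (x - v) = blockMap B (y - v)) (hx : x ∈ liftTopZ P j ((domainsOfSeq Ω j hk).Om j)) : y ∈ liftTopZ P j ((domainsOfSeq Ω j hk).Om j) := by
  have hsat : ∀ ⦃x x' : Site P 0⦄, iterBlockOf j x = iterBlockOf j x' → x ∈ Ω j → x' ∈ Ω j :=
    blockSaturated_of_mem_unionsOfCubes hk (hLB.trans hBS) hΩ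
  rw [mem_liftTopZ_domainsOfSeq_iff Ω hk hj1 hnest hsat] at hx ⊢
  refine cover_mem_of_mem_unionsOfCubes_of_blockMap_eq hB hBS hBN hΩ ?_ hx
  have ex : ∀ z : Pt P.d, (z + fun _ => ((ctrShift P.L j : ℕ) : ℤ)) = (z - v) + fun i => (B : ℤ) * γ i := by
    intro z
    rw [← hv]
    abel
  rw [ex x, ex y, blockMap_add_mul_const B hB, blockMap_add_mul_const B hB, h]

end Lift

/-! ## §4  The R8 dent premise of the pre-composed crown from the grid guard's divisibility letters -/

section Dent

variable {P : Params}

/-- ★★★ **THE DENTED TOP IS SUPERBLOCK-SATURATED** (generic regions): `1 ≤ j ≤ m + K`, `Ω` decreasing below `j`, `Ω j` a union of aligned `S`-cubes with `L^{s+1}·Lʲ ∣ S ∣ sitesPerDir 0`,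
and `L^{s+1} ∣ ρ`; then `dentFamZ P j Mc ρ a ((domainsOfSeq Ω j hk).Om j) j = □̃ᶻ_j ∩ liftTopZ …` contains with `x` every `y` of the same `L^{s+1}·Lʲ`-superblock anchored at
`Lʲ·(cornerP − ρ) − c_j`. [cite: Balaban1988Convergent, (2.1) p.254; Balaban1985Variational, (150) p.301; Balaban1987RG1, (0.3) p.252] -/
theorem dentFamZ_top_superblockSaturated (Ω : ℕ → Set (Site P 0)) {j : ℕ} (hk : j ≤ P.m + P.K) (hj1 : 1 ≤ j)
    (hnest : ∀ i : ℕ, 1 ≤ i → i < j → Ω (i + 1) ⊆ Ω i) {s S : ℕ} (hBS : P.L ^ (s + 1) * P.L ^ j ∣ S) (hSN : S ∣ P.sitesPerDir 0)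
    (hΩ : Ω j ∈ unionsOfCubes P S) (Mc ρ : ℕ) (hρ : P.L ^ (s + 1) ∣ ρ) (a : Pt P.d) :
    ∀ x y : Pt P.d,
      blockMap (P.L ^ (s + 1) * P.L ^ j) (x - fun i => (P.L : ℤ) ^ j * (cornerP P Mc ρ a i - ρ) - (ctrShift P.L j : ℤ)) =
        blockMap (P.L ^ (s + 1) * P.L ^ j) (y - fun i => (P.L : ℤ) ^ j * (cornerP P Mc ρ a i - ρ) - (ctrShift P.L j : ℤ)) →
      x ∈ dentFamZ P j Mc ρ a ((domainsOfSeq Ω j hk).Om j) j → y ∈ dentFamZ P j Mc ρ a ((domainsOfSeq Ω j hk).Om j) j := by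
  intro x y h hx
  have hQ : 0 < P.L ^ (s + 1) := pow_pos P.L_pos _
  have hB : 0 < P.L ^ (s + 1) * P.L ^ j := Nat.mul_pos hQ (pow_pos P.L_pos j)
  rw [dentFamZ_top] at hx ⊢
  refine ⟨tcubeZ_superblockSaturated hQ Mc ρ hρ a j h hx.1, ?_⟩
  -- the anchor `v` with `v + c_j·𝟙 = Lʲ·(cornerP − ρ) ∈ (L^{s+1}·Lʲ)·ℤᵈ`
  obtain ⟨q, hq⟩ := hρ
  refine liftTopZ_superblockSaturated Ω hk hj1 hnest hB (Dvd.intro_left _ rfl) hBS (hBS.trans hSN) hΩ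
    (fun i => (P.L : ℤ) ^ j * (cornerP P Mc ρ a i - ρ) - (ctrShift P.L j : ℤ)) (fun i => (q : ℤ) * (((Mc : ℤ) * a i) / (ρ : ℤ) - 1)) ?_ h hx.2
  funext i
  simp only [Pi.add_apply, cornerP, gridFloor, hq]
  push_cast
  ring

/-- ★★★ **THE R8 DENT PREMISE OF THE PRE-COMPOSED CROWN FROM THE GRID GUARD's DIVISIBILITY LETTERS** — for an admissible sequence `s` of record ((2.1): `Ω_j ∈ 𝐃_j`, unions of
`Lʲ·M·R_j`-cubes, decreasing), a datum level `1 ≤ j ≤ k`, `j ≤ m + K`, the (c-ii)‴ datum row at `Md := L^{e+1}` («`L^{e+1} ∣ M·R_j` and `Lʲ·M·R_j ∣ sitesPerDir 0`») and a collar with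
`L^{e+1} ∣ ρ`: the dented top `dentFamZ (F.P K) j Mc ρ idx ((domainsOfSeq s.Ω j hk).Om j) j` is a union of `L^{e+1}·Lʲ`-superblocks anchored at `Lʲ·(cornerP − ρ) − c_j` — verbatim
the premise displayed in `DatumCrownPhiAt` (✓p751907 :85–88). [cite: Balaban1988Convergent, (2.1) p.254, (2.5) p.255; Balaban1985Variational, (150) p.301; Balaban1987RG1, (0.1) p.251] -/
theorem dentFamZ_top_superblockSaturated_seqOfRecord (F : T4Family) (ν : Stage7Numerics) (M : ℕ) (g : ℕ → ℝ) (K k : ℕ) (sq : SeqOfRecord F ν M g K k)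
    {j : ℕ} (hk : j ≤ (F.P K).m + (F.P K).K) (hj1 : 1 ≤ j) (hjk : j ≤ k) {e : ℕ}
    (hrow : F.L ^ (e + 1) ∣ M * RkOfRecord (F.P K).L ν.r (g j) ∧ dCubeSide (F.P K).L M (RkOfRecord (F.P K).L ν.r (g j)) j ∣ (F.P K).sitesPerDir 0)
    (Mc ρ : ℕ) (hρ : F.L ^ (e + 1) ∣ ρ) (idx : Pt (F.P K).d) :
    ∀ x y : Pt (F.P K).d,
      blockMap (F.L ^ (e + 1) * F.L ^ j) (x - fun i => (F.L : ℤ) ^ j * (cornerP (F.P K) Mc ρ idx i - ρ) - (ctrShift F.L j : ℤ)) =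
        blockMap (F.L ^ (e + 1) * F.L ^ j) (y - fun i => (F.L : ℤ) ^ j * (cornerP (F.P K) Mc ρ idx i - ρ) - (ctrShift F.L j : ℤ)) →
      x ∈ dentFamZ (F.P K) j Mc ρ idx ((domainsOfSeq sq.Ω j hk).Om j) j → y ∈ dentFamZ (F.P K) j Mc ρ idx ((domainsOfSeq sq.Ω j hk).Om j) j := by
  have hnest : ∀ i : ℕ, 1 ≤ i → i < j → sq.Ω (i + 1) ⊆ sq.Ω i := fun i hi1 hij => sq.chain.Ω_succ_subset_Ω hi1 (lt_of_lt_of_le hij hjk)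
  have hΩ : sq.Ω j ∈ unionsOfCubes (F.P K) (dCubeSide (F.P K).L M (RkOfRecord (F.P K).L ν.r (g j)) j) := sq.chain.memΩ j hj1 hjk
  have hBS : (F.P K).L ^ (e + 1) * (F.P K).L ^ j ∣ dCubeSide (F.P K).L M (RkOfRecord (F.P K).L ν.r (g j)) j := by
    obtain ⟨c, hc⟩ := hrow.1
    refine ⟨c, ?_⟩
    simp only [dCubeSide, T4Family.P_L] at hc ⊢
    rw [mul_assoc (F.L ^ j), hc]
    ring
  exact dentFamZ_top_superblockSaturated sq.Ω hk hj1 hnest hBS hrow.2 hΩ Mc ρ hρ idx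

end Dent

end Literature.MathematicalPhysics.QuantumFieldTheory.Balaban1983to89.Node00
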